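import Literature.NumberTheory.GaloisCohomology.Howard2004.InertTameGeneratorRingClassProofs
import HarnessLib

/-!
# Howard 2004, Prop. 1.1.9 — the COUNTS: `#H¹_f(K_λ, T) = #T`, `#H¹(K_λ, T) = #T²`, `#H¹_tr(K_λ, T) = #T`
# (proofs file)

Topic `NumberTheory/GaloisCohomology/Howard2004` (sequel to `FiniteSingularEvaluation` (the evaluation
bijections `H¹_ur(F, N) ≅ N`, `H¹_s(F, N) ≅ N`) and `InertTameGeneratorRingClassProofs` (Prop. 1.1.9,
`H¹(K_λ, T) = H¹_f ⊕ H¹_tr` at an inert prime)).  THEOREMS ONLY: no definition, no named fact, no instance,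
no `sorry`.

B. Howard, *The Heegner point Kolyvagin system*, Compositio Math. 140 (2004), Prop. 1.1.7 and Prop. 1.1.9
(arXiv:1202.6340 p. 5 L129–141, p. 6 L17–25): for a finite module `N` with trivial action of `Γ_F` (`F` a
nonarchimedean local field) and `(q_F − 1)·N = 0`, `H¹_f ≅ N` and `H¹_s ≅ N`, so **`#H¹(F, N) = (#N)²`**; at a
degree-two (inert) prime `λ` of the imaginary quadratic `K`, `H¹(K_λ, T) = H¹_f ⊕ H¹_tr` with both summands
«free of rank two over `R`» when `T ≅ R²` — numerically **`#H¹_tr(K_λ, T) = #T`** and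
`#H¹_tr(K_λ, T) · #H¹_tr(K_λ, T) = #H¹(K_λ, T)`, the COUNT half of the self-orthogonality («maximal isotropic»,
Lemma 1.5.6 p. 10 L86–88) of the transverse condition.

* `bijective_quotientMk_of_isCompl`, `natCard_eq_natCard_quotient_of_isCompl`,
  `natCard_mul_natCard_eq_of_isCompl` — a complement `B` of `A ≤ G` (abelian) is in bijection with `G ⧸ A`.
* `natCard_unramifiedSubgroup_eq_of_trivial`, `natCard_singularQuotient_eq_of_trivial`,
  **`natCard_galoisCohomology_one_eq_sq_of_trivial`** (`#H¹(F, N) = (#N)²`),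
  `natCard_eq_of_isCompl_unramifiedSubgroup` (any complement of `H¹_ur` has `#N` elements).
* **`natCard_transverseCondition_eq_of_isImaginaryQuadratic`** (`#H¹_tr(K_λ, T) = #T`),
  `natCard_galoisCohomology_toLocal_one_eq_sq` (`#H¹(K_v, T) = (#T)²`),
  **`natCard_transverseCondition_mul_eq_of_isImaginaryQuadratic`** (`#H¹_tr · #H¹_tr = #H¹(K_λ, T)`, the
  `hcard` input of the isotropy-count criterion for H.4 at `λ ∣ n`).
Cell `pub/bsd-print-x9`, G87 (print leaf `stub_h161` of stmt-BirchSwinnertonDyer-22642); seat `bsd-line-x9-p1-w3`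
g14, brick (COUNT).  BSD is not proved by any of this.

References: [Howard2004HeegnerKolyvagin] Prop. 1.1.7, Prop. 1.1.9, Lemma 1.5.6; [MazurRubinMemoirs2004]
Lemma 1.2.1.
-/

set_option autoImplicit false

noncomputable section

open NumberField IsDedekindDomain IsDedekindDomain.HeightOneSpectrum Field

namespace Literature.NumberTheory.GaloisCohomology.Howard2004

open Literature.NumberTheory.GaloisRepresentations
open Literature.NumberTheory.GaloisRepresentations.DiscreteGaloisModule
open Literature.NumberTheory.GaloisRepresentations.IsNonarchimedeanLocalField
open Literature.NumberTheory.EllipticCurves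

/-! ## §0 Complements in an abelian group: `B ≅ G ⧸ A` -/

section Compl

variable {G : Type*} [AddCommGroup G]

/-- **A complement `B` of `A` maps bijectively onto `G ⧸ A`** (`x ↦ x + A`): injective as `A ⊓ B = ⊥`,
surjective as `A ⊔ B = ⊤`. [cite: Howard2004HeegnerKolyvagin, Prop. 1.1.9 (arXiv:1202.6340 p. 6 L17–25)] -/
theorem bijective_quotientMk_of_isCompl (A B : AddSubgroup G) (h : IsCompl A B) :
    Function.Bijective fun b : B => (QuotientAddGroup.mk (b : G) : G ⧸ A) := by
  constructor
  · intro b b' hbb'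
    have hmem : -(b : G) + b' ∈ A := QuotientAddGroup.eq.1 hbb'
    have hB : -(b : G) + b' ∈ B := B.add_mem (B.neg_mem b.2) b'.2
    have h0 : -(b : G) + b' = 0 := (AddSubgroup.disjoint_def.1 h.disjoint) hmem hB
    exact Subtype.ext (neg_add_eq_zero.1 h0)
  · intro x
    obtain ⟨x, rfl⟩ := QuotientAddGroup.mk_surjective x
    have hx : x ∈ A ⊔ B := by rw [h.sup_eq_top]; exact AddSubgroup.mem_top x
    obtain ⟨a, ha, b, hb, rfl⟩ := AddSubgroup.mem_sup.1 hx
    refine ⟨⟨b, hb⟩, QuotientAddGroup.eq.2 ?_⟩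
    rw [add_comm a b, neg_add_cancel_left]
    exact ha

/-- `#B = #(G ⧸ A)` for a complement `B` of `A`.
[cite: Howard2004HeegnerKolyvagin, Prop. 1.1.9 (arXiv:1202.6340 p. 6 L17–25)] -/
theorem natCard_eq_natCard_quotient_of_isCompl (A B : AddSubgroup G) (h : IsCompl A B) :
    Nat.card B = Nat.card (G ⧸ A) :=
  Nat.card_eq_of_bijective _ (bijective_quotientMk_of_isCompl A B h)

/-- `#A · #B = #G` for complements `A`, `B`.
[cite: Howard2004HeegnerKolyvagin, Prop. 1.1.9 (arXiv:1202.6340 p. 6 L17–25)] -/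
theorem natCard_mul_natCard_eq_of_isCompl (A B : AddSubgroup G) (h : IsCompl A B) :
    Nat.card A * Nat.card B = Nat.card G := by
  rw [natCard_eq_natCard_quotient_of_isCompl A B h, mul_comm,
    ← AddSubgroup.card_eq_card_quotient_mul_card_addSubgroup]

end Compl

/-! ## §1 Local counts for a finite module with trivial action -/

section Local

variable {F : Type} [Field F] [ValuativeRel F] [TopologicalSpace F] [IsNonarchimedeanLocalField F]
  {N : Type} [AddCommGroup N] [TopologicalSpace N] [DiscreteTopology N]

/-- **`#H¹_ur(F, N) = #N`** (trivial action, `N` finite): evaluation at a Frobenius lift is a bijection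
`H¹_ur(F, N) ≅ N` (`evalClass_bijective_unramified`; a Frobenius lift exists, `exists_isAbsArithFrob_holds`).
[cite: Howard2004HeegnerKolyvagin, Prop. 1.1.7 (arXiv:1202.6340 p. 5 L129–138)] -/
theorem natCard_unramifiedSubgroup_eq_of_trivial [Finite N] (ρ : DiscreteGaloisModule F N)
    (htriv : ∀ (σ : absoluteGaloisGroup F) (x : N), ρ σ x = x) :
    Nat.card (unramifiedSubgroup ρ 1) = Nat.card N := by
  obtain ⟨φ, hφ⟩ := exists_isAbsArithFrob_holds (F := F)
  exact Nat.card_eq_of_bijective _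
    (evalClass_bijective_unramified ρ htriv (IsAbsArithFrob.isFrobPow_holds hφ))

/-- **`#H¹_s(F, N) = #N`** (trivial action, `N` finite, `(q − 1)·N = 0`): evaluation at a tame generator is a
bijection `H¹(F, N)/H¹_ur ≅ N` (`singularEval_bijective`; a tame generator exists, `exists_isTameGenerator`).
[cite: Howard2004HeegnerKolyvagin, Prop. 1.1.7 (arXiv:1202.6340 p. 5 L138–141)]
[cite: MazurRubinMemoirs2004, Lemma 1.2.1] -/
theorem natCard_singularQuotient_eq_of_trivial [Finite N] (ρ : DiscreteGaloisModule F N)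
    (htriv : ∀ (σ : absoluteGaloisGroup F) (x : N), ρ σ x = x)
    (hq : ∀ x : N, (residueFieldCard F - 1) • x = 0) :
    Nat.card ρ.SingularQuotient = Nat.card N := by
  obtain ⟨σ₀, hσ₀⟩ := exists_isTameGenerator (F := F)
  exact Nat.card_eq_of_bijective _ (singularEval_bijective ρ htriv hσ₀ hq)

/-- **`#H¹(F, N) = (#N)²`** for a finite `N` with trivial `Γ_F`-action and `(q − 1)·N = 0`:
`#H¹ = #H¹_ur · #(H¹/H¹_ur) = #N · #N`.
[cite: Howard2004HeegnerKolyvagin, Prop. 1.1.7 (arXiv:1202.6340 p. 5 L129–141)] -/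
theorem natCard_galoisCohomology_one_eq_sq_of_trivial [Finite N] (ρ : DiscreteGaloisModule F N)
    (htriv : ∀ (σ : absoluteGaloisGroup F) (x : N), ρ σ x = x)
    (hq : ∀ x : N, (residueFieldCard F - 1) • x = 0) :
    Nat.card (galoisCohomology ρ 1) = Nat.card N ^ 2 := by
  rw [AddSubgroup.card_eq_card_quotient_mul_card_addSubgroup (unramifiedSubgroup ρ 1),
    natCard_unramifiedSubgroup_eq_of_trivial ρ htriv, sq]
  exact congrArg (· * Nat.card N) (natCard_singularQuotient_eq_of_trivial ρ htriv hq)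

/-- **Any complement of `H¹_ur(F, N)` in `H¹(F, N)` has `#N` elements** (trivial action, `N` finite,
`(q − 1)·N = 0`) — e.g. Howard's transverse condition `H¹_tr` (Prop. 1.1.9).
[cite: Howard2004HeegnerKolyvagin, Prop. 1.1.9 (arXiv:1202.6340 p. 6 L17–25)] -/
theorem natCard_eq_of_isCompl_unramifiedSubgroup [Finite N] (ρ : DiscreteGaloisModule F N)
    (htriv : ∀ (σ : absoluteGaloisGroup F) (x : N), ρ σ x = x)
    (hq : ∀ x : N, (residueFieldCard F - 1) • x = 0) {B : AddSubgroup (galoisCohomology ρ 1)}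
    (h : IsCompl (unramifiedSubgroup ρ 1) B) : Nat.card B = Nat.card N := by
  rw [natCard_eq_natCard_quotient_of_isCompl _ B h]
  exact natCard_singularQuotient_eq_of_trivial ρ htriv hq

end Local

/-! ## §2 At an inert prime of an imaginary quadratic field -/

section Inert

variable {K : Type} [Field K] [NumberField K] {M : Type} [AddCommGroup M] [TopologicalSpace M]
  [DiscreteTopology M]

/-- **`#H¹(K_v, T) = (#T)²`** for a finite `T` with trivial `Γ_{K_v}`-action and `(q_v − 1)·T = 0` (Howard
Prop. 1.1.7 / 1.1.9 numerically; at a degree-two prime `λ ∤ p` with `Frob_λ` trivial on `T`).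
[cite: Howard2004HeegnerKolyvagin, Prop. 1.1.7 and Prop. 1.1.9 (arXiv:1202.6340 p. 5 L129–141, p. 6 L17–25)] -/
theorem natCard_galoisCohomology_toLocal_one_eq_sq [Finite M] (ρ : DiscreteGaloisModule K M)
    (v : HeightOneSpectrum (𝓞 K))
    (htriv : ∀ (g : absoluteGaloisGroup (v.adicCompletion K)) (x : M), GaloisRep.toLocal v ρ g x = x)
    (hq : ∀ x : M, (residueFieldCard (v.adicCompletion K) - 1) • x = 0) :
    Nat.card (galoisCohomology (GaloisRep.toLocal v ρ) 1) = Nat.card M ^ 2 :=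
  natCard_galoisCohomology_one_eq_sq_of_trivial (GaloisRep.toLocal v ρ) htriv hq

/-- **`#H¹_tr(K_λ, T) = #T` at an inert prime** (Howard Prop. 1.1.9, numerically): for `K` imaginary
quadratic, `(ℓ)` inert, `λ ∋ ℓ`, `T` finite `p`-primary with trivial `Γ_{K_λ}`-action, `(q_λ − 1)·T = 0`,
`#G_ℓ·T = 0` and `hGexp` (exponent of `G_ℓ = Gal(K[ℓ]/K[1])` divides `q_λ − 1`), the transverse condition is a
complement of `H¹_f` (`isCompl_unramifiedSubgroup_transverseCondition_of_isImaginaryQuadratic`), hence has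
`#T` elements. [cite: Howard2004HeegnerKolyvagin, Prop. 1.1.9 (arXiv:1202.6340 p. 6 L17–25)] -/
theorem natCard_transverseCondition_eq_of_isImaginaryQuadratic [Finite M] (p : ℕ) [Fact p.Prime]
    (hK : IsImaginaryQuadratic K) (ρ : DiscreteGaloisModule K M) (jbar : AlgebraicClosure K →+* ℂ) {ℓ : ℕ}
    (hℓ : ℓ.Prime) (hℓP : (Ideal.span {(ℓ : 𝓞 K)}).IsPrime) {v : HeightOneSpectrum (𝓞 K)}
    (hv : (ℓ : 𝓞 K) ∈ v.asIdeal)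
    (htriv : ∀ (g : absoluteGaloisGroup (v.adicCompletion K)) (x : M), GaloisRep.toLocal v ρ g x = x)
    (hp : ∀ x : M, ∃ n : ℕ, p ^ n • x = 0)
    (hq : ∀ x : M, (residueFieldCard (v.adicCompletion K) - 1) • x = 0)
    (hGexp : ∀ g ∈ ringClassGalOver (jbar.comp (algebraMap K (AlgebraicClosure K))) (ℓ * 1) 1,
      g ^ (residueFieldCard (v.adicCompletion K) - 1) = 1)
    (hT : ∀ x : M,
      Nat.card (ringClassGalOver (jbar.comp (algebraMap K (AlgebraicClosure K))) (ℓ * 1) 1) • x = 0) :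
    Nat.card (transverseCondition p ρ ℓ jbar v) = Nat.card M :=
  natCard_eq_of_isCompl_unramifiedSubgroup (GaloisRep.toLocal v ρ) htriv hq
    (isCompl_unramifiedSubgroup_transverseCondition_of_isImaginaryQuadratic p hK ρ jbar hℓ hℓP hv htriv hp
      hq hGexp hT)

/-- **`#H¹_tr(K_λ, T) · #H¹_tr(K_λ', T) = #H¹(K_λ, T)`** for two places `λ, λ' ∋ ℓ` as in
`natCard_transverseCondition_eq_of_isImaginaryQuadratic` (at an inert `ℓ` necessarily `λ' = λ = σλ`): both
sides equal `(#T)²` — the COUNT input (`hcard`) of the isotropy-count criterion for the self-orthogonality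
(H.4) of Howard's `F(n)` at `λ ∣ n` (Lemma 1.5.6: «`F^m(n)` is maximal isotropic away from `m`»).
[cite: Howard2004HeegnerKolyvagin, Prop. 1.1.9 and Lemma 1.5.6 (arXiv:1202.6340 p. 6 L17–25, p. 10 L86–88)] -/
theorem natCard_transverseCondition_mul_eq_of_isImaginaryQuadratic [Finite M] (p : ℕ) [Fact p.Prime]
    (hK : IsImaginaryQuadratic K) (ρ : DiscreteGaloisModule K M) (jbar : AlgebraicClosure K →+* ℂ) {ℓ : ℕ}
    (hℓ : ℓ.Prime) (hℓP : (Ideal.span {(ℓ : 𝓞 K)}).IsPrime) {v v' : HeightOneSpectrum (𝓞 K)}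
    (hv : (ℓ : 𝓞 K) ∈ v.asIdeal) (hv' : (ℓ : 𝓞 K) ∈ v'.asIdeal)
    (htriv : ∀ (g : absoluteGaloisGroup (v.adicCompletion K)) (x : M), GaloisRep.toLocal v ρ g x = x)
    (htriv' : ∀ (g : absoluteGaloisGroup (v'.adicCompletion K)) (x : M), GaloisRep.toLocal v' ρ g x = x)
    (hp : ∀ x : M, ∃ n : ℕ, p ^ n • x = 0)
    (hq : ∀ x : M, (residueFieldCard (v.adicCompletion K) - 1) • x = 0)
    (hq' : ∀ x : M, (residueFieldCard (v'.adicCompletion K) - 1) • x = 0)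
    (hGexp : ∀ g ∈ ringClassGalOver (jbar.comp (algebraMap K (AlgebraicClosure K))) (ℓ * 1) 1,
      g ^ (residueFieldCard (v.adicCompletion K) - 1) = 1)
    (hGexp' : ∀ g ∈ ringClassGalOver (jbar.comp (algebraMap K (AlgebraicClosure K))) (ℓ * 1) 1,
      g ^ (residueFieldCard (v'.adicCompletion K) - 1) = 1)
    (hT : ∀ x : M,
      Nat.card (ringClassGalOver (jbar.comp (algebraMap K (AlgebraicClosure K))) (ℓ * 1) 1) • x = 0) :
    Nat.card (transverseCondition p ρ ℓ jbar v) * Nat.card (transverseCondition p ρ ℓ jbar v') =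
      Nat.card (galoisCohomology (GaloisRep.toLocal v ρ) 1) := by
  rw [natCard_transverseCondition_eq_of_isImaginaryQuadratic p hK ρ jbar hℓ hℓP hv htriv hp hq hGexp hT,
    natCard_transverseCondition_eq_of_isImaginaryQuadratic p hK ρ jbar hℓ hℓP hv' htriv' hp hq' hGexp' hT,
    natCard_galoisCohomology_toLocal_one_eq_sq ρ v htriv hq, sq]

end Inert

end Literature.NumberTheory.GaloisCohomology.Howard2004

end
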